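import Summits.QuantumFields.BalabanUV.Beta.D1BFx.NeedleDipDipLetters
import Summits.QuantumFields.BalabanUV.Beta.D1BFx.GluonLocalProjWord

/-!
# `BalabanUV.Beta.D1BFx.GluonLocalDipEnds` — road «BF-x» for binder row D1, slot (K), END row `hGrp gN`, «GN-K» LETTERS: THE FOUR LEG ENDS OF THE
# `SbT ⊗ dip` WORD AS WINDOW MAJORANTS — Coulomb `|Ga∇δρ_b| ≤ K_δρ·e^{−(ε∕n)‖q−b‖}∕nrm(q−b)²` (by parts, (3,3)), `|Ga∇ρ_b| ≤ K_ρ·e∕nrm¹` with unit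
# differences `≤ K′_ρ·e∕nrm²` ((2,3), (3,3) on `∇ρ`'s own letter), flat `|Ga∇p_b| ≤ K_p ∝ n⁻³`, differences `K′_p ∝ n⁻⁴`, `|Ga∇δp_b| ≤ K_δp ∝ n⁻⁴`,
# all from leaf-04-g9's letter packs at a common rate — the inputs of the summed frame `LocalVertexByPartsSum` for the K-piece of T₁

HONEST DEPENDENCY (cell records, verbatim): «continuum YM on T⁴ ⇐ BetaPertH ∧ nine spine estimates (0/9 proved); BetaPertH ⇐ (D1) ∧ (D4) ∧
CAP+tail; G-an2-4 gates asym, D1 and NE2/3/4.»  HONEST FRAMING (cell contract, verbatim): «discharging `BetaPertH` makes Bałaban's UV stability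
UNCONDITIONAL — a real constructive-QFT result; it is NOT the continuum limit and NOT the Clay problem.»  THIS MODULE DISCHARGES NOTHING of the
wall: [folklore] lattice bookkeeping BY NAME over leaf-04-g9's `PairingByParts.abs_applyK_grad_le_of_damped_profiles` (by parts + HLS (3,3)),
`LatticeHLSDamped.abs_applyK_le_of_damped_profiles` ∕ `_flat` (damped HLS), the owner's `GluonLocalProjWord.profile_window` (window shift) and
`TameKernelCalculus.Spr` (summabilities).  EVERY LETTER IS A HYPOTHESIS here (entry ∕ d1 profiles of the leg, the four function letters of the dipole);
no printed statement is named, no `def`, no `def … : Prop`, nothing cited, 0 sorry.  Asserts NO bound on any table of the road.  Root-level binders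
hW ∕ hR-sockets ∕ hSX-socket ∕ D1Tel ∕ D1Rep — 0 discharged; (K) NOT closed; NOT D1, NOT `BetaPertH`, NOT continuum, NOT Clay.

ABSOLUTE RULE (cell charter, verbatim): «No internally-minted statement may enter as a cited fact. Every hypothesis is either kernel-proved in
this package or a verbatim quotation of a PUBLISHED theorem with page reference. The manuscript(s) under audit are NOT citable for their own
disputed steps — they are the thing under adjudication; programme-internal (2001/route/tribunal) claims are never citable.»

WHY (FINDING F-d1leaf03g13-1, journal 2026-08-21 ≈12:08Z; owner records `GLUON-NEEDLE-ROWS.md` v0.2∕v0.3 «GN-CELLS» row «T₁ K-piece»; leaf-04-g9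
YIELD l.≈31300).  `dipPiece ν b = ∇δρ_b⊗∇p_b + ∇ρ_b⊗∇δp_b − ∇p_b⊗∇δρ_b − ∇δp_b⊗∇ρ_b` (`NeedleDipShape.dipPiece_eq_outer`); against the local
`SbT μ (b+w)` each rank-one term is a list vertex with the two ENDS `Ga∇f` (`f` one of the four functions; `ψGa = Gaψ` by the leg's symmetry).  The
summed frame needs, per term, the window VALUES of the bad end and the values ∕ unit differences of the good end, as functions of `w`: this file
supplies them at one `n`, from letters stated as hypotheses in EXACTLY the shapes of leaf-04-g9's `NeedleDipDipLetters.exists_legLetters` ∕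
`exists_functionLetters` and `GluonLegProfileD1.exists_abs_Ga_diff_left_le_profile`.
* §1 [folklore] `summable_row_mul`, `summable_col_mul` (spread leg × bounded bond function), **`applyK_fdiff_left`** (a unit difference of `Ga φ` in
  its site = the differenced leg applied to `φ`), `bracket_two_le` ∕ `bracket_three_le` (the damped-flat HLS brackets at `s = 4n∕ε₀ ≥ 1`), `window_read`.
* §2 [folklore] COULOMB ENDS: **`abs_applyK_grad_drho_le`** (`K_δρ·e∕nrm²`, K_δρ = 4·C₄·kA₁·kR∕n²`), **`abs_applyK_grad_rho_le`** (`4·C₄·kA·kR∕n²·e∕nrm`),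
  **`abs_applyK_grad_rho_diff_le`** (`4·C₄·kL·kR∕n²·e∕nrm²`); `C₄ = 4·2⁷·9³`.
* §3 [folklore] FLAT ENDS: **`abs_applyK_grad_p_le`** (`4·kA·cF∕n⁵·433·(4n∕ε₀)²`), **`abs_applyK_grad_p_diff_le`** (`4·kL·cF∕n⁵·433·(4n∕ε₀)`),
  **`abs_applyK_grad_dp_le`** (`4·kA·cF∕n⁶·433·(4n∕ε₀)²`).
NOT HERE (honest): the frame, the (1.22) sums, the word, the cell (`GluonLocalDipSum`, `GluonLocalDipRow`).
Unit `b2b-balaban-beta-d1-formalise-leaf-03` (gen 13), D1 formalisation swarm, road «BF-x»; `LEAVES-BFx.md` row (N) «GN-K» (letters).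
-/

noncomputable section

namespace Summit.QuantumFields.BalabanUV.Beta.D1BFx.GluonLocalDipEnds

open Finset
open scoped BigOperators
open Literature.MathematicalPhysics.QuantumFieldTheory.Balaban1983to89
open Literature.MathematicalPhysics.QuantumFieldTheory.Balaban1983to89.Beta
open B12Sec2to5 (l1 l1_nonneg)
open ExpKernelCalculus (Site MKer Decays summable_exp_shift summable_exp_shift')
open DyadicShell (Pt)
open AffineAveraging (unitVec)
open PoissonInterior (nrm nrm_pos one_le_nrm nrm_neg supNorm supNorm_neg)
open Summit.QuantumFields.BalabanUV.Beta.TameKernelCalculus (Spr)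
open Summit.QuantumFields.BalabanUV.Beta.D1BFx.RankOneBubble (applyK applyKT applyK_apply applyKT_apply)
open Summit.QuantumFields.BalabanUV.Beta.D1BFx.RankOneBubbleJets (grad grad_apply)
open Summit.QuantumFields.BalabanUV.Beta.D1BFx.LatticeHLSDamped (abs_applyK_le_of_damped_profiles abs_applyK_le_of_damped_flat)
open Summit.QuantumFields.BalabanUV.Beta.D1BFx.PairingByParts (abs_applyK_grad_le_of_damped_profiles)
open Summit.QuantumFields.BalabanUV.Beta.D1BFx.LatticeHLSProfiles (supNorm_dyadic)
open Summit.QuantumFields.BalabanUV.Beta.D1BFx.GluonLocalProjWord (profile_window)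

/-! ## §1 Generic bookkeeping -/

section Generic

/-- [folklore] **A SPREAD LEG ROW AGAINST A BOUNDED BOND FUNCTION IS SUMMABLE** (fibre sum inside). -/
theorem summable_row_mul {A : MKer 4 (Fin 4)} (hA : Spr A) {φ : Site 4 → Fin 4 → ℝ} {M : ℝ} (hφ : ∀ y b, |φ y b| ≤ M) (x : Site 4) (c : Fin 4) :
    Summable fun y : Site 4 => ∑ b, A x y c b * φ y b := by
  obtain ⟨C, δ, hδ, hAd⟩ := hA
  have hC : 0 ≤ C := hAd.nonneg c
  have hM : 0 ≤ M := (abs_nonneg _).trans (hφ x c)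
  refine Summable.of_norm_bounded ((summable_exp_shift hδ x).mul_left (4 * (C * M))) fun y => ?_
  rw [Real.norm_eq_abs]
  calc |∑ b, A x y c b * φ y b| ≤ ∑ b, |A x y c b * φ y b| := abs_sum_le_sum_abs _ _
    _ ≤ ∑ _b : Fin 4, C * Real.exp (-δ * l1 (x - y)) * M := sum_le_sum fun b _ => by
        rw [abs_mul]; exact mul_le_mul (hAd x y c b) (hφ y b) (abs_nonneg _) (by positivity)
    _ = 4 * (C * M) * Real.exp (-δ * l1 (x - y)) := by
        rw [sum_const, card_univ, Fintype.card_fin, nsmul_eq_mul]; push_cast; ring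

/-- [folklore] **A BOUNDED BOND FUNCTION AGAINST A SPREAD LEG COLUMN IS SUMMABLE** (the row-end summability of the frame). -/
theorem summable_col_mul {A : MKer 4 (Fin 4)} (hA : Spr A) {ψ : Site 4 → Fin 4 → ℝ} {M : ℝ} (hψ : ∀ x a, |ψ x a| ≤ M) (s : Site 4) (g : Fin 4) :
    Summable fun x : Site 4 => ∑ a, ψ x a * A x s a g := by
  obtain ⟨C, δ, hδ, hAd⟩ := hA
  have hC : 0 ≤ C := hAd.nonneg g
  have hM : 0 ≤ M := (abs_nonneg _).trans (hψ s g)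
  refine Summable.of_norm_bounded ((summable_exp_shift' hδ s).mul_left (4 * (C * M))) fun x => ?_
  rw [Real.norm_eq_abs]
  calc |∑ a, ψ x a * A x s a g| ≤ ∑ a, |ψ x a * A x s a g| := abs_sum_le_sum_abs _ _
    _ ≤ ∑ _a : Fin 4, M * (C * Real.exp (-δ * l1 (x - s))) := sum_le_sum fun a _ => by
        rw [abs_mul]; exact mul_le_mul (hψ x a) (hAd x s a g) (abs_nonneg _) hM
    _ = 4 * (C * M) * Real.exp (-δ * l1 (x - s)) := by
        rw [sum_const, card_univ, Fintype.card_fin, nsmul_eq_mul]; push_cast; ring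

/-- [folklore] **A UNIT DIFFERENCE OF `Ga φ` IN ITS SITE IS THE DIFFERENCED LEG APPLIED TO `φ`**:
`(Aφ)(x+e,c) − (Aφ)(x,c) = Σ'_y Σ_b (A(x+e,y)_{cb} − A(x,y)_{cb})·φ(y,b)` (spread leg, bounded bond function). -/
theorem applyK_fdiff_left {A : MKer 4 (Fin 4)} (hA : Spr A) {φ : Site 4 → Fin 4 → ℝ} {M : ℝ} (hφ : ∀ y b, |φ y b| ≤ M) (x e : Site 4) (c : Fin 4) :
    applyK A φ (x + e) c - applyK A φ x c = applyK (fun x y c b => A (x + e) y c b - A x y c b) φ x c := by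
  rw [applyK_apply, applyK_apply, applyK_apply, ← (summable_row_mul hA hφ (x + e) c).tsum_sub (summable_row_mul hA hφ x c)]
  refine tsum_congr fun y => ?_
  rw [← Finset.sum_sub_distrib]
  exact Finset.sum_congr rfl fun b _ => by ring

/-- [folklore] The damped-flat HLS bracket at exponent `2` (`d = 4`): `1 + 2·4·3³·(1!·s·(1+s)) ≤ 433·s²` for `s ≥ 1`. -/
theorem bracket_two_le {s : ℝ} (hs : 1 ≤ s) :
    (1 : ℝ) + 2 * (4 : ℕ) * 3 ^ (4 - 1) * (((4 - 1 - 2 : ℕ).factorial : ℝ) * s ^ (4 - 1 - 2) * (1 + s)) ≤ 433 * s ^ 2 := by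
  norm_num
  nlinarith [hs, sq_nonneg s]

/-- [folklore] The damped-flat HLS bracket at exponent `3` (`d = 4`): `1 + 2·4·3³·(0!·1·(1+s)) ≤ 433·s` for `s ≥ 1`. -/
theorem bracket_three_le {s : ℝ} (hs : 1 ≤ s) :
    (1 : ℝ) + 2 * (4 : ℕ) * 3 ^ (4 - 1) * (((4 - 1 - 3 : ℕ).factorial : ℝ) * s ^ (4 - 1 - 3) * (1 + s)) ≤ 433 * s := by
  norm_num
  nlinarith [hs]

/-- [folklore] **A DAMPED PROFILE CENTRED AT `b`, READ IN THE WINDOW AROUND `b + w`** (the owner's `profile_window` with `q − b = w + (q − (b+w))`):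
`k·e^{−(δ∕n)‖q−b‖}∕nrm(q−b)^p ≤ k·(e^{δR}(R+1)^p)·e^{−(δ∕n)‖w‖}∕nrm(w)^p` for `‖q − (b+w)‖∞ ≤ R`. -/
theorem window_read {k δ : ℝ} (hk : 0 ≤ k) (hδ : 0 ≤ δ) {n : ℕ} (hn : 1 ≤ n) (p : ℕ) {R : ℕ} (b w q : Pt) (hq : DyadicShell.supNorm (q - (b + w)) ≤ R) :
    k * Real.exp (-(δ / n) * supNorm (q - b)) / nrm (q - b) ^ p
      ≤ k * (Real.exp (δ * R) * ((R : ℝ) + 1) ^ p) * (Real.exp (-(δ / n) * supNorm w) / nrm w ^ p) := by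
  have e : q - b = w + (q - (b + w)) := by abel
  rw [e]
  exact profile_window hk hδ hn p (by rw [← supNorm_dyadic]; exact hq)

end Generic

/-! ## §2 The Coulomb ends `Ga∇δρ_b`, `Ga∇ρ_b` -/

section Coulomb

variable (n : ℕ) [NeZero n] {A : MKer 4 (Fin 4)} {ε₀ kA kA' kA₁ kL kR : ℝ} (b : Site 4)

/-- [folklore] **THE DIPOLE END BY PARTS**: with the entry letters `kA`, `kA'` (shifted), the backward second-site d1 letter `kA₁` of the leg and the dipole
letter `|δρ_b(x)| ≤ kR∕n²·e∕nrm(x−b)³`:  `|(Ga∇δρ_b)(q,c)| ≤ 4·kA₁·(kR∕n²)·C₄·e^{−(ε₀∕n)‖q−b‖}∕nrm(q−b)²` (leaf-04-g9's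
`abs_applyK_grad_le_of_damped_profiles`, instantiated; `C₄ = 4·2⁷·9³`). -/
theorem abs_applyK_grad_drho_le (hε₀ : 0 < ε₀) (hkA : 0 ≤ kA) (hkA' : 0 ≤ kA') (hkA₁ : 0 ≤ kA₁) (hkR : 0 ≤ kR)
    (hA0 : ∀ (x y : Site 4) (c d : Fin 4), |A x y c d| ≤ kA * Real.exp (-(ε₀ / n) * supNorm (x - y)) / nrm (x - y) ^ 2)
    (hA0' : ∀ (x y : Site 4) (c d : Fin 4), |A x (y - unitVec d) c d| ≤ kA' * Real.exp (-(ε₀ / n) * supNorm (x - y)) / nrm (x - y) ^ 2)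
    (hA1 : ∀ (x y : Site 4) (c d : Fin 4), |A x (y - unitVec d) c d - A x y c d| ≤ kA₁ * Real.exp (-(ε₀ / n) * supNorm (x - y)) / nrm (x - y) ^ 3)
    {f : Site 4 → ℝ} (hf : ∀ x : Site 4, |f x| ≤ kR / (n : ℝ) ^ 2 * Real.exp (-(ε₀ / n) * supNorm (x - b)) / nrm (x - b) ^ 3)
    (q : Site 4) (c : Fin 4) :
    |applyK A (grad f) q c| ≤ 4 * kA₁ * (kR / (n : ℝ) ^ 2) * (4 * 2 ^ (4 + 3) * 9 ^ (4 - 1)) * Real.exp (-(ε₀ / n) * supNorm (q - b)) / nrm (q - b) ^ 2 := by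
  have hn : (0 : ℝ) < n := by exact_mod_cast Nat.pos_of_ne_zero (NeZero.ne n)
  exact abs_applyK_grad_le_of_damped_profiles hkA hkA' hkA₁ (by positivity) (by positivity) b hA0 hA0' hA1 hf q c

/-- [folklore] **THE COLUMN END, VALUES**: with the entry letter `kA` of the leg and the gradient letter `|∇ρ_b(x,a)| ≤ kR∕n²·e∕nrm(x−b)³`:
`|(Ga∇ρ_b)(q,c)| ≤ 4·kA·(kR∕n²)·C₄·e^{−(ε₀∕n)‖q−b‖}∕nrm(q−b)` (damped HLS (2,3) ↦ 1). -/
theorem abs_applyK_grad_rho_le (hε₀ : 0 < ε₀) (hkA : 0 ≤ kA) (hkR : 0 ≤ kR)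
    (hA0 : ∀ (x y : Site 4) (c d : Fin 4), |A x y c d| ≤ kA * Real.exp (-(ε₀ / n) * supNorm (x - y)) / nrm (x - y) ^ 2)
    {φ : Site 4 → Fin 4 → ℝ} (hφ : ∀ (x : Site 4) (a : Fin 4), |φ x a| ≤ kR / (n : ℝ) ^ 2 * Real.exp (-(ε₀ / n) * supNorm (x - b)) / nrm (x - b) ^ 3)
    (q : Site 4) (c : Fin 4) :
    |applyK A φ q c| ≤ 4 * kA * (kR / (n : ℝ) ^ 2) * (4 * 2 ^ (4 + 3) * 9 ^ (4 - 1)) * Real.exp (-(ε₀ / n) * supNorm (q - b)) / nrm (q - b) ^ 1 := by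
  have hn : (0 : ℝ) < n := by exact_mod_cast Nat.pos_of_ne_zero (NeZero.ne n)
  have h := abs_applyK_le_of_damped_profiles (d := 4) (F := Fin 4) (by norm_num) (a := 2) (b := 3) (by norm_num) (by norm_num) (by norm_num)
    hkA (by positivity : (0 : ℝ) ≤ kR / (n : ℝ) ^ 2) (by positivity : (0 : ℝ) ≤ ε₀ / n) b hA0 hφ q c
  simp only [Fintype.card_fin] at h
  norm_num at h ⊢
  linarith

/-- [folklore] **THE COLUMN END, UNIT DIFFERENCES**: with the forward first-site d1 letter `kL` of the leg (any direction) and the same gradient letter: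
`|(Ga∇ρ_b)(q+e_i,c) − (Ga∇ρ_b)(q,c)| ≤ 4·kL·(kR∕n²)·C₄·e^{−(ε₀∕n)‖q−b‖}∕nrm(q−b)²` (the difference sits on the LEG: (3,3) ↦ 2; no second
difference of `ρ_b`). -/
theorem abs_applyK_grad_rho_diff_le (hA : Spr A) (hε₀ : 0 < ε₀) (hkL : 0 ≤ kL) (hkR : 0 ≤ kR)
    (hAL : ∀ (x y : Site 4) (c d i : Fin 4), |A (x + unitVec i) y c d - A x y c d| ≤ kL * Real.exp (-(ε₀ / n) * supNorm (x - y)) / nrm (x - y) ^ 3)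
    {φ : Site 4 → Fin 4 → ℝ} (hφ : ∀ (x : Site 4) (a : Fin 4), |φ x a| ≤ kR / (n : ℝ) ^ 2 * Real.exp (-(ε₀ / n) * supNorm (x - b)) / nrm (x - b) ^ 3)
    (q : Site 4) (c i : Fin 4) :
    |applyK A φ (q + unitVec i) c - applyK A φ q c|
      ≤ 4 * kL * (kR / (n : ℝ) ^ 2) * (4 * 2 ^ (4 + 3) * 9 ^ (4 - 1)) * Real.exp (-(ε₀ / n) * supNorm (q - b)) / nrm (q - b) ^ 2 := by
  have hn : (0 : ℝ) < n := by exact_mod_cast Nat.pos_of_ne_zero (NeZero.ne n)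
  have hφb : ∀ (x : Site 4) (a : Fin 4), |φ x a| ≤ kR / (n : ℝ) ^ 2 := fun x a => (hφ x a).trans (by
    have h1 : Real.exp (-(ε₀ / n) * supNorm (x - b)) ≤ 1 := by
      rw [Real.exp_le_one_iff]; have : (0 : ℝ) ≤ supNorm (x - b) := Nat.cast_nonneg _; nlinarith [div_pos hε₀ hn]
    have h2 := one_le_nrm (d := 4) (x - b)
    calc kR / (n : ℝ) ^ 2 * Real.exp (-(ε₀ / n) * supNorm (x - b)) / nrm (x - b) ^ 3
        ≤ kR / (n : ℝ) ^ 2 * 1 / 1 := by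
          refine div_le_div₀ (by positivity) (mul_le_mul_of_nonneg_left h1 (by positivity)) one_pos (one_le_pow₀ h2)
      _ = kR / (n : ℝ) ^ 2 := by ring)
  rw [applyK_fdiff_left hA hφb q (unitVec i) c]
  have h := abs_applyK_le_of_damped_profiles (d := 4) (F := Fin 4) (by norm_num) (a := 3) (b := 3) (by norm_num) (by norm_num) (by norm_num)
    (A := fun x y c d => A (x + unitVec i) y c d - A x y c d) hkL (by positivity : (0 : ℝ) ≤ kR / (n : ℝ) ^ 2) (by positivity : (0 : ℝ) ≤ ε₀ / n) b
    (fun x y c d => hAL x y c d i) hφ q c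
  simp only [Fintype.card_fin] at h
  norm_num at h ⊢
  linarith

end Coulomb

/-! ## §3 The flat ends `Ga∇p_b`, `Ga∇δp_b` -/

section Flat

variable (n : ℕ) [NeZero n] {A : MKer 4 (Fin 4)} {ε₀ kA kL B : ℝ} (b : Site 4)

/-- [folklore] `s := 4n∕ε₀ = 2∕((ε₀∕n)∕2) ≥ 1` for `0 < ε₀ ≤ 1`, `n ≥ 1`. -/
theorem one_le_s (hε₀ : 0 < ε₀) (hε₀1 : ε₀ ≤ 1) : (1 : ℝ) ≤ 2 / (ε₀ / (n : ℝ) / 2) ∧ 2 / (ε₀ / (n : ℝ) / 2) = 4 * n / ε₀ := by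
  have hn1 : (1 : ℝ) ≤ n := by exact_mod_cast NeZero.one_le
  have e : 2 / (ε₀ / (n : ℝ) / 2) = 4 * n / ε₀ := by field_simp; ring
  refine ⟨?_, e⟩
  rw [e, le_div_iff₀ hε₀]; nlinarith

/-- [folklore] **A FLAT DAMPED BOND FUNCTION THROUGH THE LEG, VALUES**: entry letter `kA` and `|φ(y,b)| ≤ B·e^{−(ε₀∕n)‖y−b‖}` give
`|(Aφ)(q,c)| ≤ 4·kA·B·433·(4n∕ε₀)²` (damped-flat HLS at exponent 2; the half-rate damping of the output dropped). -/
theorem abs_applyK_flat_le (hε₀ : 0 < ε₀) (hε₀1 : ε₀ ≤ 1) (hkA : 0 ≤ kA) (hB : 0 ≤ B)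
    (hA0 : ∀ (x y : Site 4) (c d : Fin 4), |A x y c d| ≤ kA * Real.exp (-(ε₀ / n) * supNorm (x - y)) / nrm (x - y) ^ 2)
    {φ : Site 4 → Fin 4 → ℝ} (hφ : ∀ (y : Site 4) (d : Fin 4), |φ y d| ≤ B * Real.exp (-(ε₀ / n) * supNorm (y - b))) (q : Site 4) (c : Fin 4) :
    |applyK A φ q c| ≤ 4 * kA * B * (433 * (4 * n / ε₀) ^ 2) := by
  have hn : (0 : ℝ) < n := by exact_mod_cast Nat.pos_of_ne_zero (NeZero.ne n)
  obtain ⟨hs, es⟩ := one_le_s n hε₀ hε₀1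
  have h := abs_applyK_le_of_damped_flat (d := 4) (F := Fin 4) (by norm_num) (a := 2) (by norm_num) hkA hB (div_pos hε₀ hn) b hA0 hφ q c
  simp only [Fintype.card_fin] at h
  have hbr := bracket_two_le hs
  have hexp : Real.exp (-(ε₀ / n / 2) * supNorm (q - b)) ≤ 1 := by
    rw [Real.exp_le_one_iff]; have : (0 : ℝ) ≤ supNorm (q - b) := Nat.cast_nonneg _; nlinarith [div_pos hε₀ hn]
  refine h.trans ?_
  have h0 : (0 : ℝ) ≤ (4 : ℕ) * kA * B := by positivity
  calc ((4 : ℕ) : ℝ) * kA * B * Real.exp (-(ε₀ / n / 2) * supNorm (q - b)) *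
        (1 + 2 * (4 : ℕ) * 3 ^ (4 - 1) * (((4 - 1 - 2 : ℕ).factorial : ℝ) * (2 / (ε₀ / n / 2)) ^ (4 - 1 - 2) * (1 + 2 / (ε₀ / n / 2))))
      ≤ ((4 : ℕ) : ℝ) * kA * B * 1 * (433 * (2 / (ε₀ / n / 2)) ^ 2) :=
        mul_le_mul (mul_le_mul_of_nonneg_left hexp h0) hbr (by positivity) (by positivity)
    _ = 4 * kA * B * (433 * (4 * n / ε₀) ^ 2) := by rw [es]; push_cast; ring

/-- [folklore] **A FLAT DAMPED BOND FUNCTION THROUGH THE LEG, UNIT DIFFERENCES**: the forward first-site d1 letter `kL` (any direction) and the same flat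
letter give `|(Aφ)(q+e_i,c) − (Aφ)(q,c)| ≤ 4·kL·B·433·(4n∕ε₀)` (exponent 3: one power of `n` better than the values). -/
theorem abs_applyK_flat_diff_le (hA : Spr A) (hε₀ : 0 < ε₀) (hε₀1 : ε₀ ≤ 1) (hkL : 0 ≤ kL) (hB : 0 ≤ B)
    (hAL : ∀ (x y : Site 4) (c d i : Fin 4), |A (x + unitVec i) y c d - A x y c d| ≤ kL * Real.exp (-(ε₀ / n) * supNorm (x - y)) / nrm (x - y) ^ 3)
    {φ : Site 4 → Fin 4 → ℝ} (hφ : ∀ (y : Site 4) (d : Fin 4), |φ y d| ≤ B * Real.exp (-(ε₀ / n) * supNorm (y - b))) (q : Site 4) (c i : Fin 4) :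
    |applyK A φ (q + unitVec i) c - applyK A φ q c| ≤ 4 * kL * B * (433 * (4 * n / ε₀)) := by
  have hn : (0 : ℝ) < n := by exact_mod_cast Nat.pos_of_ne_zero (NeZero.ne n)
  obtain ⟨hs, es⟩ := one_le_s n hε₀ hε₀1
  have hφb : ∀ (y : Site 4) (d : Fin 4), |φ y d| ≤ B := fun y d => (hφ y d).trans (mul_le_of_le_one_right hB (by
    rw [Real.exp_le_one_iff]; have : (0 : ℝ) ≤ supNorm (y - b) := Nat.cast_nonneg _; nlinarith [div_pos hε₀ hn]))
  rw [applyK_fdiff_left hA hφb q (unitVec i) c]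
  have h := abs_applyK_le_of_damped_flat (d := 4) (F := Fin 4) (by norm_num) (a := 3) (by norm_num) hkL hB (div_pos hε₀ hn) b
    (A := fun x y c d => A (x + unitVec i) y c d - A x y c d) (fun x y c d => hAL x y c d i) hφ q c
  simp only [Fintype.card_fin] at h
  have hbr := bracket_three_le hs
  have hexp : Real.exp (-(ε₀ / n / 2) * supNorm (q - b)) ≤ 1 := by
    rw [Real.exp_le_one_iff]; have : (0 : ℝ) ≤ supNorm (q - b) := Nat.cast_nonneg _; nlinarith [div_pos hε₀ hn]
  refine h.trans ?_
  have h0 : (0 : ℝ) ≤ (4 : ℕ) * kL * B := by positivity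
  calc ((4 : ℕ) : ℝ) * kL * B * Real.exp (-(ε₀ / n / 2) * supNorm (q - b)) *
        (1 + 2 * (4 : ℕ) * 3 ^ (4 - 1) * (((4 - 1 - 3 : ℕ).factorial : ℝ) * (2 / (ε₀ / n / 2)) ^ (4 - 1 - 3) * (1 + 2 / (ε₀ / n / 2))))
      ≤ ((4 : ℕ) : ℝ) * kL * B * 1 * (433 * (2 / (ε₀ / n / 2))) :=
        mul_le_mul (mul_le_mul_of_nonneg_left hexp h0) hbr (by positivity) (by positivity)
    _ = 4 * kL * B * (433 * (4 * n / ε₀)) := by rw [es]; push_cast; ring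

end Flat

end Summit.QuantumFields.BalabanUV.Beta.D1BFx.GluonLocalDipEnds

end
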